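import Mathlib
import Literature.Computability.AlgebraicComplexity.GroupTheoreticMatMulThmBProofs

/-!
# Counting size profiles of concatenation powers — stub `stub_typeCount` of line `Sketch`
(crux `AutomaticPackingThesis`, stmt-MatrixMultiplication-7356)

For weights `a b c : Fin n → ℕ` (the block sizes of an STPP design with `n` triples), the blocks
of the `m`-th concatenation power are indexed by words `w : Fin m → Fin n` and have the SIZE
PROFILE `(Π_t a (w t), Π_t b (w t), Π_t c (w t)) ∈ ℕ × ℕ × ℕ`. The profile of `w` only depends
on the word TYPE `i ↦ #{t : w t = i} ∈ Fin (m + 1)` (Blasiak–Church–Cohn–Grochow–Naslund–Sawin–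
Umans 2017, proof of Lemma 3.5: `Π_t f (w t) = Π_i f i ^ type(w)ᵢ`, in tree as
`Combinatorics.prod_eq_prod_pow_wordType`), so the number of distinct profiles is at most the
number of types, `|Fin n → Fin (m + 1)| = (m + 1) ^ n`. This is the pigeonhole denominator of the
uniform normal form of the crux.
-/

set_option linter.dupNamespace false
-- (single-conjunct summit: the namespace repeats `MatrixMultiplication`)

namespace Summit.MatrixMultiplication.MatrixMultiplication.Theorems.AutomaticPackingThesis

open Finset Literature.Computability.AlgebraicComplexity

/-- The size-profile map `w ↦ (Π_t a (w t), Π_t b (w t), Π_t c (w t))` on words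
`w : Fin m → Fin n` factors through the word type `Combinatorics.wordType w : Fin n → Fin (m + 1)`
(`Combinatorics.prod_eq_prod_pow_wordType`): its image is contained in the image of
`τ ↦ (Π_i a i ^ τᵢ, Π_i b i ^ τᵢ, Π_i c i ^ τᵢ)` over all `τ : Fin n → Fin (m + 1)`.
[cite: BlasiakChurchCohnGrochowNaslundSawinUmans2017, Lemma 3.5 (proof)] -/
theorem image_profile_subset_image_type (n m : ℕ) (a b c : Fin n → ℕ) :
    (Finset.univ.image fun w : Fin m → Fin n =>
      (∏ t, a (w t), ∏ t, b (w t), ∏ t, c (w t))) ⊆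
    Finset.univ.image fun τ : Fin n → Fin (m + 1) =>
      (∏ i, a i ^ (τ i : ℕ), ∏ i, b i ^ (τ i : ℕ), ∏ i, c i ^ (τ i : ℕ)) := by
  intro x hx
  obtain ⟨w, -, rfl⟩ := Finset.mem_image.1 hx
  refine Finset.mem_image.2 ⟨Combinatorics.wordType w, Finset.mem_univ _, ?_⟩
  rw [Combinatorics.prod_eq_prod_pow_wordType a w, Combinatorics.prod_eq_prod_pow_wordType b w,
    Combinatorics.prod_eq_prod_pow_wordType c w]

/-- **Size profiles are few** (registered stub `stub_typeCount` of line `Sketch`): for weights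
`a b c : Fin n → ℕ`, the words `w : Fin m → Fin n` have at most `(m + 1) ^ n` distinct size
profiles `(Π_t a (w t), Π_t b (w t), Π_t c (w t))`, because the profile only depends on the
word type `i ↦ #{t : w t = i} ∈ Fin (m + 1)` (`image_profile_subset_image_type`) and there are
`(m + 1) ^ n` types (`Finset.card_image_le`, `Fintype.card_fun`, `Fintype.card_fin`).
[cite: BlasiakChurchCohnGrochowNaslundSawinUmans2017, Lemma 3.5 (proof)] -/
theorem stub_typeCount (n m : ℕ) (a b c : Fin n → ℕ) :
    (Finset.univ.image fun w : Fin m → Fin n =>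
      (∏ t, a (w t), ∏ t, b (w t), ∏ t, c (w t))).card ≤ (m + 1) ^ n :=
  calc (Finset.univ.image fun w : Fin m → Fin n =>
        (∏ t, a (w t), ∏ t, b (w t), ∏ t, c (w t))).card
      ≤ (Finset.univ.image fun τ : Fin n → Fin (m + 1) =>
          (∏ i, a i ^ (τ i : ℕ), ∏ i, b i ^ (τ i : ℕ), ∏ i, c i ^ (τ i : ℕ))).card :=
        Finset.card_le_card (image_profile_subset_image_type n m a b c)
    _ ≤ (Finset.univ : Finset (Fin n → Fin (m + 1))).card := Finset.card_image_le
    _ = (m + 1) ^ n := by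
        rw [Finset.card_univ, Fintype.card_fun, Fintype.card_fin, Fintype.card_fin]

end Summit.MatrixMultiplication.MatrixMultiplication.Theorems.AutomaticPackingThesis
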